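import Literature.Topology.FourManifolds.LickorishTwistLink
import Literature.Topology.FourManifolds.DehnSurgeryFramingTransfer
import Literature.Topology.FourManifolds.RadialSaturation
import HarnessLib

/-!
# Trimming an oriented tubular neighbourhood to a thin tube

Infrastructure (theorems only) for the connected-sum decomposition of surgery on a split link
(`Literature.Topology.FourManifolds.exists_isSurgery_zeroFramedUnlink`, `KirbyCalculus.lean`).
An oriented tubular neighbourhood `ν : 𝕊¹ × ℝ² ↪ 𝕊³` of a knot (`Knot.TubularNbhd`,
`DehnSurgery.lean`) is an embedding of the *whole* plane bundle, and the surgery predicate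
`IsIntegralSurgeryLink` asks the images of the tubular neighbourhoods of the components of a link
to be pairwise disjoint — whereas the surgery relation `surgeryRel ν`, the meridian and the
longitude (hence the framing) only see `ν` on the open unit disc bundle `‖w‖ < 1`. This file
**trims** `ν`: given an open set `V` containing the closed unit tube `ν (𝕊¹ × D̄²)`, there is an
oriented tubular neighbourhood `ν'` of the same knot which agrees with `ν` on the closed unit disc
bundle, has the same framings, and whose whole image lies in `V` (and in the image of `ν`):
`ν' (x, w) = ν (x, λ w)` for the radial saturation `λ` of the fibre (`RadialSaturation.lean`:
identity on the unit disc, image in a slightly larger disc), oriented by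
`Knot.TubularNbhd.ofLocalDiffeomorph` (the frame determinant of `ν'` agrees with that of `ν`
along the zero section, so the positive branch is taken).

* `Knot.TubularNbhd.exists_trim`.

## References

* D. Rolfsen, *Knots and Links* (1976), §9.F (the surgery uses a tubular neighbourhood "of any
  radius").
* A. Kosinski, *Differential Manifolds* (1993), III (3.4) (shrinking tubular neighbourhoods).
-/

open scoped Manifold ContDiff Topology RealInnerProductSpace
open Set Function Metric Module Filter

noncomputable section

namespace Literature.Topology.FourManifolds

/-- Local notation: `𝔼 n` is the model Euclidean space `EuclideanSpace ℝ (Fin n)`. -/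
local notation "𝔼 " n:arg => EuclideanSpace ℝ (Fin n)

/-- Local notation: `𝕊 n` is the unit sphere in `EuclideanSpace ℝ (Fin (n + 1))`. -/
local notation "𝕊 " n:arg => (Metric.sphere (0 : EuclideanSpace ℝ (Fin (n + 1))) 1)

/-- Local notation: the model with corners of `S¹ × ℝ²`. -/
local notation "𝓘₁₂" => (ModelWithCorners.prod (𝓡 1) 𝓘(ℝ, EuclideanSpace ℝ (Fin 2)))

attribute [local instance] fact_finrank_euclideanSpace_two fact_finrank_euclideanSpace_four

/-! ### The radial saturation of the plane -/

/-- **The radial saturation of the plane.** For `0 < ε` there is a `C^∞` injective map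
`lam : ℝ² → ℝ²` which is the identity on the closed unit disc, maps the whole plane into the open
disc of radius `1 + ε`, and is a local diffeomorphism at every point (indeed a diffeomorphism
onto an open disc): the radial map with the saturation profile of `RadialSaturation.lean`.
[folklore] -/
theorem exists_planeSaturation {ε : ℝ} (hε : 0 < ε) :
    ∃ lam : 𝔼 2 → 𝔼 2, ContDiff ℝ ∞ lam ∧ Injective lam ∧ (∀ w, ‖w‖ ≤ 1 → lam w = w) ∧
      (∀ w, ‖lam w‖ < 1 + ε) ∧ (∀ w, IsLocalDiffeomorphAt 𝓘(ℝ, 𝔼 2) 𝓘(ℝ, 𝔼 2) ∞ lam w) ∧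
      ∃ Λ : OpenPartialHomeomorph (𝔼 2) (𝔼 2), (⇑Λ = lam) ∧ Λ.source = univ ∧
        ContDiffOn ℝ ∞ Λ.symm Λ.target := by
  have hab : (1 : ℝ) < 1 + ε := by linarith
  obtain ⟨ℓ, hℓs, hℓd, hℓmono, hℓid, hℓlt, hℓge⟩ := exists_saturationProfile hab
  -- the profile as a function of the squared norm
  set φ : ℝ → ℝ := fun s ↦ if s ≤ 1 / 4 then 1 else ℓ (Real.sqrt s) / Real.sqrt s with hφ
  have hφ_one : ∀ s, s ≤ 1 → φ s = 1 := by
    intro s hs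
    simp only [hφ]
    split_ifs with h
    · rfl
    · have hs0 : 0 < s := by linarith
      have hsq : Real.sqrt s ≤ 1 := Real.sqrt_le_one.mpr hs
      have hsq0 : 0 < Real.sqrt s := Real.sqrt_pos.2 hs0
      rw [hℓid _ hsq, div_self hsq0.ne']
  have hφ_gt : ∀ s, 1 / 4 < s → φ s = ℓ (Real.sqrt s) / Real.sqrt s := by
    intro s hs; simp only [hφ, if_neg (not_le.2 hs)]
  have hrad : ∀ t, 0 ≤ t → t * φ (t ^ 2) = ℓ t := by
    intro t ht
    by_cases h : t ^ 2 ≤ 1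
    · rw [hφ_one _ h, mul_one, hℓid]
      nlinarith
    · rw [hφ_gt _ (by linarith [not_le.1 h]), Real.sqrt_sq ht]
      have ht0 : 0 < t := by
        rcases eq_or_lt_of_le ht with rfl | h'
        · norm_num at h
        · exact h'
      field_simp
  -- smoothness of the profile on `[0, ∞)`
  have hφs : ∀ s, 0 ≤ s → ContDiffAt ℝ ∞ φ s := by
    intro s hs
    by_cases h : s < 1
    · have hev : φ =ᶠ[𝓝 s] fun _ ↦ (1 : ℝ) :=
        Filter.eventually_of_mem (Iio_mem_nhds h) fun s' hs' ↦ hφ_one s' (le_of_lt hs')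
      exact contDiffAt_const.congr_of_eventuallyEq hev
    · have hs4 : 1 / 4 < s := by linarith [not_lt.1 h]
      have hev : φ =ᶠ[𝓝 s] fun s ↦ ℓ (Real.sqrt s) / Real.sqrt s :=
        Filter.eventually_of_mem (Ioi_mem_nhds hs4) fun s' hs' ↦ hφ_gt s' hs'
      have hs0 : s ≠ 0 := by linarith
      have h1 : ContDiffAt ℝ ∞ Real.sqrt s := Real.contDiffAt_sqrt hs0
      exact ((hℓs.contDiffAt.comp s h1).div h1 (Real.sqrt_pos.2 (by linarith)).ne').congr_of_eventuallyEq hev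
  have hφpos : ∀ t, 0 ≤ t → 0 < φ (t ^ 2) := by
    intro t ht
    by_cases h : t ^ 2 ≤ 1
    · rw [hφ_one _ h]; exact one_pos
    · have ht1 : 1 < t := by nlinarith [not_le.1 h]
      rw [hφ_gt _ (by linarith [not_le.1 h]), Real.sqrt_sq ht]
      exact div_pos (by linarith [hℓge t ht1.le]) (by linarith)
  have hder : ∀ t, 0 ≤ t → 0 < φ (t ^ 2) + 2 * t ^ 2 * deriv φ (t ^ 2) := by
    intro t ht
    by_cases h : t ^ 2 < 1
    · have hev : φ =ᶠ[𝓝 (t ^ 2)] fun _ ↦ (1 : ℝ) :=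
        Filter.eventually_of_mem (Iio_mem_nhds h) fun s' hs' ↦ hφ_one s' (le_of_lt hs')
      rw [hev.deriv_eq, deriv_const, mul_zero, add_zero, hφ_one _ h.le]
      exact one_pos
    · have ht1 : 1 ≤ t := by nlinarith [not_lt.1 h]
      have hdφ : HasDerivAt φ (deriv φ (t ^ 2)) (t ^ 2) :=
        ((hφs _ (sq_nonneg t)).differentiableAt (by simp)).hasDerivAt
      rw [← (hasDerivAt_radialProfile hdφ).deriv]
      have hev : (fun t : ℝ ↦ t * φ (t ^ 2)) =ᶠ[𝓝 t] ℓ :=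
        Filter.eventually_of_mem (Ioi_mem_nhds (by linarith : (0 : ℝ) < t))
          fun t' ht' ↦ hrad t' (le_of_lt ht')
      rw [hev.deriv_eq]
      exact hℓd t
  obtain ⟨hinj, hsmooth, Λ, hΛf, hsrc, htgt, -, hsymm⟩ :=
    exists_openPartialHomeomorph_radial (E := 𝔼 2) hφs hφpos hder
  refine ⟨fun w ↦ φ (‖w‖ ^ 2) • w, hsmooth, hinj, fun w hw ↦ ?_, fun w ↦ ?_, fun w ↦ ?_, Λ, hΛf, hsrc,
    by rw [htgt]; exact hsymm⟩
  · show φ (‖w‖ ^ 2) • w = w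
    rw [hφ_one _ (by nlinarith [norm_nonneg w]), one_smul]
  · show ‖φ (‖w‖ ^ 2) • w‖ < 1 + ε
    rw [norm_smul, Real.norm_eq_abs, abs_of_pos (hφpos _ (norm_nonneg w)), mul_comm,
      hrad _ (norm_nonneg w)]
    exact hℓlt _
  · exact isLocalDiffeomorphAt_of_contDiffOn_openPartialHomeomorph Λ (by rw [hsrc]; trivial)
      (by rw [hΛf, hsrc]; exact hsmooth.contDiffOn) (by rw [htgt]; exact hsymm)
      (Filter.Eventually.of_forall fun w ↦ by rw [hΛf])

/-! ### Trimming a tubular neighbourhood -/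

namespace Knot.TubularNbhd

/-- The frame determinant of a map only depends on its germ. [folklore] -/
theorem tubeFrameDet_congr_of_eventuallyEq {G G' : ℝ × 𝔼 2 → 𝔼 4} {q : ℝ × 𝔼 2}
    (h : G =ᶠ[𝓝 q] G') : tubeFrameDet G q = tubeFrameDet G' q := by
  rw [tubeFrameDet_def, tubeFrameDet_def, h.fderiv_eq, h.eq_of_nhds]

/-- The frame determinant of an oriented tubular neighbourhood is positive. [folklore] -/
theorem tubeFrameDet_coordOf_pos {K : Knot} (ν : Knot.TubularNbhd K) (q : ℝ × 𝔼 2) :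
    0 < tubeFrameDet (coordOf ⇑ν) q := by
  obtain ⟨θ, w⟩ := q
  rw [tubeFrameDet_eq_det_deriv ((contDiff_coordOf ν.contMDiff).differentiable (by simp))]
  exact ν.det_pos θ w

/-- **Trimming an oriented tubular neighbourhood.** Let `ν` be an oriented tubular
neighbourhood of the knot `K` and `V ⊆ 𝕊 3` an open set containing the closed unit tube
`ν (𝕊¹ × D̄²)`. Then there is an oriented tubular neighbourhood `ν'` of `K` which agrees with `ν`
on the closed unit disc bundle (so `surgeryRel ν' = surgeryRel ν` and the meridian and longitude
are unchanged), whose image lies in `V` and in the image of `ν`, and which has the same framings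
as `ν`: `ν' (x, w) = ν (x, λ w)` with `λ` the radial saturation of the fibre. Rolfsen (1976),
§9.F ("of any radius"); Kosinski (1993), III (3.4). [folklore] -/
theorem exists_trim {K : Knot} (ν : Knot.TubularNbhd K) {V : Set (𝕊 3)} (hV : IsOpen V)
    (hνV : ν '' (univ ×ˢ Metric.closedBall 0 1) ⊆ V) :
    ∃ ν' : Knot.TubularNbhd K, (∀ (x : 𝕊 1) (w : 𝔼 2), ‖w‖ ≤ 1 → ν' (x, w) = ν (x, w)) ∧
      range ν' ⊆ V ∧ range ν' ⊆ range ν ∧ ∀ m : ℤ, ν'.HasFraming m ↔ ν.HasFraming m := by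
  -- a thickened tube inside `V`
  have hpre : IsOpen (⇑ν ⁻¹' V) := hV.preimage ν.continuous
  have hcpt : IsCompact ((univ : Set (𝕊 1)) ×ˢ Metric.closedBall (0 : 𝔼 2) 1) :=
    isCompact_univ.prod (isCompact_closedBall 0 1)
  obtain ⟨δ, hδ, hthick⟩ := hcpt.exists_thickening_subset_open hpre (image_subset_iff.1 hνV)
  have hmemV : ∀ (x : 𝕊 1) (w : 𝔼 2), ‖w‖ < 1 + δ → ν (x, w) ∈ V := by
    intro x w hw
    refine hthick (Metric.mem_thickening_iff.2 ?_)
    by_cases hw1 : ‖w‖ ≤ 1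
    · exact ⟨(x, w), ⟨mem_univ _, by simpa using hw1⟩, by simpa using hδ⟩
    · have hw0 : 0 < ‖w‖ := by linarith [not_le.1 hw1]
      refine ⟨(x, ‖w‖⁻¹ • w), ⟨mem_univ _, ?_⟩, ?_⟩
      · rw [Metric.mem_closedBall, dist_zero_right, norm_smul, norm_inv, norm_norm,
          inv_mul_cancel₀ hw0.ne']
      · rw [Prod.dist_eq, dist_self]
        have hd : dist w (‖w‖⁻¹ • w) = ‖w‖ - 1 := by
          rw [dist_eq_norm]
          have : w - ‖w‖⁻¹ • w = (1 - ‖w‖⁻¹) • w := by rw [sub_smul, one_smul]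
          rw [this, norm_smul, Real.norm_eq_abs, abs_of_nonneg (by
            rw [sub_nonneg]; exact inv_le_one_of_one_le₀ (le_of_lt (not_le.1 hw1)))]
          field_simp
        rw [hd, max_eq_right (by linarith [not_le.1 hw1])]
        linarith
  -- the fibre saturation
  obtain ⟨lam, hlams, hlaminj, hlamid, hlamlt, -, Λ, hΛf, hsrc, hsymm⟩ :=
    exists_planeSaturation (half_pos hδ)
  have hlam0 : lam 0 = 0 := hlamid 0 (by simp)
  -- `(x, w) ↦ (x, λ w)` is a local diffeomorphism of `S¹ × ℝ²`
  have hPcoe : ∀ q : (𝕊 1) × 𝔼 2,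
      ((PartialEquiv.refl (𝕊 1)).prod Λ.toPartialEquiv) q = Prod.map id lam q := fun q ↦
    Prod.ext rfl (by change Λ q.2 = lam q.2; rw [hΛf])
  have hPsymm : ∀ q : (𝕊 1) × 𝔼 2,
      ((PartialEquiv.refl (𝕊 1)).prod Λ.toPartialEquiv).symm q = Prod.map id Λ.symm q := fun q ↦ by
    rw [PartialEquiv.prod_symm]; rfl
  have hidS : ContMDiffOn (𝓡 1) (𝓡 1) ∞ (id : 𝕊 1 → 𝕊 1) univ := contMDiff_id.contMDiffOn
  have hΛsymm : ContMDiffOn 𝓘(ℝ, 𝔼 2) 𝓘(ℝ, 𝔼 2) ∞ Λ.symm Λ.target := contMDiffOn_iff_contDiffOn.2 hsymm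
  set P : PartialDiffeomorph 𝓘₁₂ 𝓘₁₂ ((𝕊 1) × 𝔼 2) ((𝕊 1) × 𝔼 2) ∞ :=
    { toPartialEquiv := (PartialEquiv.refl (𝕊 1)).prod Λ.toPartialEquiv
      open_source := by
        rw [PartialEquiv.prod_source, PartialEquiv.refl_source]
        exact isOpen_univ.prod Λ.open_source
      open_target := by
        rw [PartialEquiv.prod_target, PartialEquiv.refl_target]
        exact isOpen_univ.prod Λ.open_target
      contMDiffOn_toFun := by
        have hid : ContMDiff (𝓡 1) (𝓡 1) ∞ (id : 𝕊 1 → 𝕊 1) := contMDiff_id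
        have h : ContMDiff 𝓘₁₂ 𝓘₁₂ ∞ (Prod.map id lam) := hid.prodMap hlams.contMDiff
        exact h.contMDiffOn.congr fun q _ ↦ hPcoe q
      contMDiffOn_invFun := by
        have h : ContMDiffOn 𝓘₁₂ 𝓘₁₂ ∞ (Prod.map id Λ.symm) ((univ : Set (𝕊 1)) ×ˢ Λ.target) :=
          hidS.prodMap hΛsymm
        refine (h.congr fun q _ ↦ hPsymm q).mono ?_
        rw [PartialEquiv.prod_target, PartialEquiv.refl_target] } with hP
  have hloc₁ : ∀ q : (𝕊 1) × 𝔼 2, IsLocalDiffeomorphAt 𝓘₁₂ 𝓘₁₂ ∞ (Prod.map id lam) q := fun q ↦ by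
    refine ⟨P, ?_, fun y _ ↦ (hPcoe y).symm⟩
    change q ∈ ((PartialEquiv.refl (𝕊 1)).prod Λ.toPartialEquiv).source
    rw [PartialEquiv.prod_source, PartialEquiv.refl_source, hsrc]
    exact ⟨mem_univ _, mem_univ _⟩
  -- the trimmed map
  set f : (𝕊 1) × 𝔼 2 → 𝕊 3 := ⇑ν ∘ Prod.map id lam with hf
  have hfapply : ∀ x w, f (x, w) = ν (x, lam w) := fun x w ↦ rfl
  have hloc : IsLocalDiffeomorph 𝓘₁₂ (𝓡 3) ∞ f := fun q ↦
    IsLocalDiffeomorphAt.comp (hf := hloc₁ q)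
      (hg := LickorishTwist.isLocalDiffeomorph_of_tube ν.isSmoothEmbedding_coe _)
  have hinj : Injective f := ν.injective.comp fun q q' h ↦ by
    obtain ⟨h1, h2⟩ := Prod.ext_iff.1 h
    exact Prod.ext h1 (hlaminj h2)
  have hK : ∀ x, f (x, 0) = K x := fun x ↦ by rw [hfapply, hlam0, ν.coe_apply_zero]
  -- its frame determinant is positive (it agrees with `ν` near the zero section)
  have hpos : ∀ q, 0 < tubeFrameDet (coordOf f) q := by
    rcases tubeFrameDet_coordOf_pos_or_neg hloc with h | h
    · exact h
    · exfalso
      have hev : coordOf f =ᶠ[𝓝 ((0 : ℝ), (0 : 𝔼 2))] coordOf ⇑ν := by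
        have hU : (univ : Set ℝ) ×ˢ Metric.ball (0 : 𝔼 2) 1 ∈ 𝓝 ((0 : ℝ), (0 : 𝔼 2)) :=
          (isOpen_univ.prod Metric.isOpen_ball).mem_nhds ⟨mem_univ _, by simp⟩
        refine Filter.eventually_of_mem hU fun q hq ↦ ?_
        obtain ⟨θ, w⟩ := q
        have hw : ‖w‖ < 1 := by simpa using hq.2
        rw [coordOf_apply, coordOf_apply, hfapply, hlamid w hw.le]
      have h1 := h ((0 : ℝ), (0 : 𝔼 2))
      rw [tubeFrameDet_congr_of_eventuallyEq hev] at h1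
      exact absurd h1 (not_lt.2 (tubeFrameDet_coordOf_pos ν _).le)
  -- the trimmed tubular neighbourhood
  set ν' := Knot.TubularNbhd.ofLocalDiffeomorph hloc hinj hK with hν'
  have hν'f : ∀ q, ν' q = f q := ofLocalDiffeomorph_apply_of_pos hloc hinj hK hpos
  have hν'eq : ∀ (x : 𝕊 1) (w : 𝔼 2), ‖w‖ ≤ 1 → ν' (x, w) = ν (x, w) := fun x w hw ↦ by
    rw [hν'f, hfapply, hlamid w hw]
  refine ⟨ν', hν'eq, ?_, ?_, fun m ↦ ⟨fun h ↦ ?_, fun h ↦ ?_⟩⟩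
  · rintro _ ⟨⟨x, w⟩, rfl⟩
    rw [hν'f, hfapply]
    exact hmemV x _ (by linarith [hlamlt w])
  · rintro _ ⟨⟨x, w⟩, rfl⟩
    rw [hν'f, hfapply]
    exact mem_range_self _
  · exact h.transfer (ContinuousMap.id _) one_half_pos fun a x w hw ha ↦ by
      rw [ContinuousMap.id_apply, ha, hν'eq x w (by rw [hw]; norm_num)]
  · exact h.transfer (ContinuousMap.id _) one_half_pos fun a x w hw ha ↦ by
      rw [ContinuousMap.id_apply, ha, hν'eq x w (by rw [hw]; norm_num)]

end Knot.TubularNbhd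

end Literature.Topology.FourManifolds
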